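import Summits.RiemannHypothesis.RiemannHypothesis.Theorems.TiltedLandingLaw421R3GainTwoPoint

/-!
# TiltedLandingLaw421R3SinkTemplate — the two-point SINK CERTIFICATE, typed (W08 C3 «LP corner-cell law», rh-idea-3 g55; IMAGE v1, RSV-102)

SUPPORT for ⟨33346⟩ (`TiltedLandingLaw421R`), K only: this module ASSERTS NO LAW.  It types the vocabulary of the η-free sink certificate of the C3 memo
(`pub/ideators/rh-idea-3/g55/sink/TWOPOINT-SINK-C3-g55.md` §2–§4) by which the far-field modulus sink `RhW08.FLink.FarFieldModulusLawBoxPl lam`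
(`…R3FLink` :333; `TModAllowanceBoxPlSig`, `lam² ≤ 5/4`) is to be reduced to finitely many one-dimensional kernel inequalities, and proves the two pieces
that are pure bookkeeping.  Every law-like declaration is a `def … : Prop`:

* `KernelDom` (K) / `KernelDomBdry` (K∂) — kernel domination of a finite CUT family on the MAXIMAL far strip `R/2 ≤ |Re u − xv|, |Im u| ≤ R/2`;
* `LemmaHSig` — boundary domination ⇒ domination (harmonic maximum principle on the two half-strips; a TRUE classical statement, NOT proved here);
* `AssemblySig` — the certificate's bookkeeping; PROVED (`sinkAssembly`; decl names `farPairK`/`farPairC`/`ConeChild`/`sinkAssembly` chosen to avoid the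
  tree's unrelated short names `pairK` (lace expansion), `pairC` (motives), `ConeDatum` (resolution of singularities), `assembly_holds'` (Nyman–Beurling));
* `DatumAlt` (D), `CertificatesExistSig lam` — the reduction target (certificates exist for every datum in the sink's scope; OPEN, numerically `lam = √5/2`
  with margin ≥ 2.9 % of the seam level on frames `26·s ≤ R`, memo §3);
* `CornerDominanceSig` — the ONE conjectural kernel law of the explicit real-part certificate, typed WITH its tested scope (floating point only: 0 failures
  in ≈ 22 000 cases); `rhoClosed` / `one_lt_rhoClosed` / `r1_bound` — the near-axis rule R1 («the box top sees more imaginary far field than the child»).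

MODEL ↔ TREE.  The model pairs each far zero `u` of `f⁽ʲ⁾` with `ū` (`f` real on ℝ): `farPairK u z = 1/(z − u) + 1/(z − ū)`; the tree's complete far list
(`RhW08.GainTwoPoint.farList_twoPoint`, #1251) lists `u` and `ū` as separate entries — re-pairing is the consumer's job (C4 «FarPricing»).  The READ VALUE `G`
of `AssemblySig` is v3's line remainder `RhW08.FLinkGain.lineRem f j v R` at the child `w` and at the axis points `p_k` (seam reads `|lineRem| ≤ η/s`).

MULTIPLICITY OF THE TRACKED STATE (director (CA916) Q-m).  The sink binds `v`'s near window only as a SET, so a tracked `v` of order `m ≥ 2` is in scope.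
`lineRem` already nets ALL `m` copies of the pair out (its `∑ᶠ` carries the weights `(analyticOrderAt (iteratedDeriv j f) u).toNat`), hence at a child `w`
(`levelField f j w = 0`):  `G(w) = lineRem f j v R w = farFieldAt f j v w − (m − 1)·farPairK v w = −m·farPairK v w`, the identity (E) reads `−Im G(w) = Σ' mᵢ·c(aᵢ)`
over FAR zeros only, and the two-point sums `G(p_k) − G(w)` are far-only (#1251).  Accordingly `AssemblySig` is stated for an abstract read value `G`, and
`CertificatesExistSig` carries the multiplicity `mult ≥ 1` explicitly: the certificate level is computed from `G = −mult·farPairK v w` while the quantity bounded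
is the one-copy far field `‖farPairK v w‖ = ‖farFieldAt f j v w‖`; the datum LP is degree-one homogeneous in `(G, Q)`, so multiplicity only helps (`λ(m) = λ(1)/m`).

RH is not proved; ⟨33346⟩/⟨33347⟩ OPEN; every `…LawSig` of the W07/W08 books OPEN; nothing in this file bears on the truth of RH.
-/

noncomputable section

open Complex
open scoped ComplexConjugate

namespace RhW08.SinkTemplate

/-! ## §1 Kernels of a conjugate pair of far zeros; cut families -/

/-- the conjugate-PAIR kernel of a far zero `u` read at `z`: `K_u(z) = 1/(z − u) + 1/(z − ū)` (two entries `1/(z − aᵢ)` of #1251's far list, `f` real). -/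
def farPairK (u z : ℂ) : ℂ := 1 / (z - u) + 1 / (z - conj u)

/-- `c(u) := −Im K_u(w)` — what the pair `{u, ū}` contributes (per unit multiplicity) to `Q = −Im G(w)` in the identity (E) `−Im G(w) = Σ_u m_u · c(u)`. -/
def farPairC (w u : ℂ) : ℝ := -(farPairK u w).im

/-- a CUT of the certificate: an axis reading point `p`, a direction `e` (a unit complex number) and a weight `y`. -/
structure Cut where
  /-- the reading point (on the axis `Re z = xv`, strictly inside the near window) -/
  p : ℂ
  /-- the direction of the read: the cut uses `Re(conj e · G(p)) ≤ L` -/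
  e : ℂ
  /-- the weight (nonnegative, summing to one over the family) -/
  y : ℝ

variable {κ : Type} [Fintype κ]

/-- the kernel NUMERATOR of a finite cut family at the child `w`: `N(u) = Σ_k y_k · Re(conj e_k · (K_u(w) − K_u(p_k)))`.
SIGN CONVENTION: with `e_k = −1` this is `Σ_k y_k · (Re K_u(p_k) − Re K_u(w))`, and the seam read `Re(conj e_k · G(p_k)) ≤ L` unfolds, by the two-point
identity `G(p_k) = G(w) − Σ_u m_u (K_u(w) − K_u(p_k))`, to `Re(conj e_k · G(w)) − Σ_u m_u · Re(conj e_k · (K_u(w) − K_u(p_k))) ≤ L`. -/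
def cutNumer (cs : κ → Cut) (w u : ℂ) : ℝ :=
  ∑ k, (cs k).y * (conj (cs k).e * (farPairK u w - farPairK u (cs k).p)).re

/-- the CERTIFIED LEVEL of a cut family with multiplier `σ` at read value `G` (= `lineRem f j v R w`): `L_cert = Σ_k y_k · Re(conj e_k · G) − σ·Q`, `Q = −Im G`. -/
def Lcert (cs : κ → Cut) (G : ℂ) (σ : ℝ) : ℝ :=
  ∑ k, (cs k).y * (conj (cs k).e * G).re - σ * (-G.im)

/-- an ADMISSIBLE cut family about the axis `Re z = xv`: nonnegative weights summing to `1`, unit directions, reading points ON the axis. -/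
def CutsAdmissible (xv : ℝ) (cs : κ → Cut) : Prop :=
  (∀ k, 0 ≤ (cs k).y ∧ ‖(cs k).e‖ = 1 ∧ (cs k).p.re = xv) ∧ ∑ k, (cs k).y = 1

/-! ## §2 The maximal far strip and kernel domination (K) -/

/-- the MAXIMAL far strip of window `R` about the axis `Re z = xv`: `R/2 ≤ |Re u − xv|` and `|Im u| ≤ R/2`.  It contains every frame's far region
`R/2 ≤ |Re u − Re v|, |Im u| ≤ Hs` because `EngineHyps5 2` gives `2·Hs ≤ R`; kernel laws are stated here so that thin lids inherit them by restriction. -/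
def MaxStrip (xv R : ℝ) (u : ℂ) : Prop := R / 2 ≤ |u.re - xv| ∧ |u.im| ≤ R / 2

/-- the boundary of the maximal strip: the two inner columns `|Re u − xv| = R/2` and the four lid rays `|Im u| = R/2`. -/
def MaxStripBdry (xv R : ℝ) (u : ℂ) : Prop :=
  (|u.re - xv| = R / 2 ∧ |u.im| ≤ R / 2) ∨ (R / 2 ≤ |u.re - xv| ∧ |u.im| = R / 2)

/-- (K) KERNEL DOMINATION with multiplier `σ`: `N(u) ≤ σ·c(u)` for every `u` in the maximal strip. -/
def KernelDom (xv R : ℝ) (cs : κ → Cut) (w : ℂ) (σ : ℝ) : Prop :=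
  ∀ u : ℂ, MaxStrip xv R u → cutNumer cs w u ≤ σ * farPairC w u

/-- (K∂) kernel domination on the BOUNDARY of the maximal strip only. -/
def KernelDomBdry (xv R : ℝ) (cs : κ → Cut) (w : ℂ) (σ : ℝ) : Prop :=
  ∀ u : ℂ, MaxStripBdry xv R u → cutNumer cs w u ≤ σ * farPairC w u

/-- LEMMA H (a TRUE classical statement; NOT proved in this module): `u ↦ N(u) − σ·c(u)` is the real part of a function meromorphic in `u` whose poles
`{w, w̄, p_k, p̄_k}` lie strictly inside the near window `|Re z − xv| < R/2`; it is harmonic on the two open half-strips, continuous up to their boundary and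
tends to `0` at infinity inside them, so boundary domination implies domination (maximum principle on truncated rectangles, or
`Literature.Analysis.Complex.harmonic_le_of_frontier_of_cocompact`).  True for every real `σ` and all real weights; degenerate-true for `R ≤ 0`. -/
def LemmaHSig : Prop :=
  ∀ (κ : Type) [Fintype κ] (xv R : ℝ) (cs : κ → Cut) (w : ℂ) (σ : ℝ),
    |w.re - xv| < R / 2 → (∀ k, |(cs k).p.re - xv| < R / 2) →
    KernelDomBdry xv R cs w σ → KernelDom xv R cs w σ

/-! ## §3 The assembly (bookkeeping) and the datum alternative (D) -/

/-- ASSEMBLY.  Data: a complete PAIRED far family `(a i, m i)` (`m i ≥ 0`) inside the maximal strip; an admissible cut family with kernel domination (K)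
for some real `σ`; summability of the two-point terms and of `m·c`; the imaginary identity (E) `−Im G = Σ' mᵢ·c(aᵢ)` at the child (`G = lineRem f j v R w`,
all `m` copies of the tracked pair netted out — see the module docstring, Q-m); and the SEAM READS `Re(conj e_k · G(p_k)) ≤ L` written through the
two-point identity as `Re(conj e_k · G) − Σ' mᵢ · Re(conj e_k · (K_{aᵢ}(w) − K_{aᵢ}(p_k))) ≤ L` (`L = η/s`).  Conclusion: `L_cert ≤ L`. -/
def AssemblySig : Prop :=
  ∀ (κ : Type) [Fintype κ] (ι : Type) (a : ι → ℂ) (m : ι → ℝ) (xv R : ℝ) (cs : κ → Cut) (w G : ℂ) (L σ : ℝ),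
    (∀ i, 0 ≤ m i) → (∀ i, MaxStrip xv R (a i)) →
    CutsAdmissible xv cs → KernelDom xv R cs w σ →
    (∀ k, Summable fun i => m i * (conj (cs k).e * (farPairK (a i) w - farPairK (a i) (cs k).p)).re) →
    (Summable fun i => m i * farPairC w (a i)) →
    (-G.im = ∑' i, m i * farPairC w (a i)) →
    (∀ k, (conj (cs k).e * G).re - ∑' i, m i * (conj (cs k).e * (farPairK (a i) w - farPairK (a i) (cs k).p)).re ≤ L) →
    Lcert cs G σ ≤ L

/-- DATUM ALTERNATIVE (D) for exponent `lam` at seam scale `s`, bounding the modulus `gnorm` (= `‖farFieldAt f j v w‖`) from the certified level at read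
value `G`: EITHER `gnorm / lam ≤ L_cert` (then `L_cert ≤ L = η/s` gives the sink inequality `gnorm ≤ lam·η/s`), OR `1/(2s) < L_cert` (then the child is not
realisable under the cap `2η ≤ 1` of `EngineHyps5 2`: `L = η/s ≤ 1/(2s) < L_cert ≤ L`). -/
def DatumAlt (lam s gnorm : ℝ) (cs : κ → Cut) (G : ℂ) (σ : ℝ) : Prop :=
  gnorm / lam ≤ Lcert cs G σ ∨ 1 / (2 * s) < Lcert cs G σ

/-- The assembly is bookkeeping: weighted seam reads, the `Finset`/`tsum` exchange, kernel domination termwise under the series, and (E). -/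
theorem sinkAssembly : AssemblySig := by
  intro κ _ ι a m xv R cs w G L σ hm hstrip hadm hK hsum hsumc hE hseam
  set T : κ → ι → ℝ := fun k i => m i * (conj (cs k).e * (farPairK (a i) w - farPairK (a i) (cs k).p)).re with hT
  have h1 : ∀ k, (cs k).y * (conj (cs k).e * G).re ≤ (cs k).y * L + (cs k).y * ∑' i, T k i := by
    intro k
    have hy : 0 ≤ (cs k).y := (hadm.1 k).1
    have hs : (conj (cs k).e * G).re ≤ L + ∑' i, T k i := by
      have := hseam k
      linarith
    nlinarith [mul_le_mul_of_nonneg_left hs hy]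
  have h2 : ∑ k, (cs k).y * (conj (cs k).e * G).re ≤ L + ∑ k, (cs k).y * ∑' i, T k i := by
    calc ∑ k, (cs k).y * (conj (cs k).e * G).re
        ≤ ∑ k, ((cs k).y * L + (cs k).y * ∑' i, T k i) := Finset.sum_le_sum fun k _ => h1 k
      _ = (∑ k, (cs k).y) * L + ∑ k, (cs k).y * ∑' i, T k i := by
          rw [Finset.sum_add_distrib, Finset.sum_mul]
      _ = L + ∑ k, (cs k).y * ∑' i, T k i := by rw [hadm.2, one_mul]
  have hsum' : ∀ k, Summable fun i => (cs k).y * T k i := fun k => (hsum k).mul_left _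
  have h3 : ∑ k, (cs k).y * ∑' i, T k i = ∑' i, m i * cutNumer cs w (a i) := by
    have e1 : ∀ k, (cs k).y * ∑' i, T k i = ∑' i, (cs k).y * T k i := fun k => (tsum_mul_left).symm
    simp_rw [e1]
    rw [← Summable.tsum_finsetSum (fun k _ => hsum' k)]
    refine tsum_congr fun i => ?_
    unfold cutNumer
    rw [Finset.mul_sum]
    refine Finset.sum_congr rfl fun k _ => ?_
    simp only [hT]
    ring
  have hsumN : Summable fun i => m i * cutNumer cs w (a i) := by
    have : (fun i => m i * cutNumer cs w (a i)) = fun i => ∑ k, (cs k).y * T k i := by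
      funext i
      unfold cutNumer
      rw [Finset.mul_sum]
      refine Finset.sum_congr rfl fun k _ => ?_
      simp only [hT]
      ring
    rw [this]
    exact summable_sum fun k _ => hsum' k
  have hsumS : Summable fun i => m i * (σ * farPairC w (a i)) := by
    have : (fun i => m i * (σ * farPairC w (a i))) = fun i => σ * (m i * farPairC w (a i)) := by
      funext i; ring
    rw [this]
    exact hsumc.mul_left σ
  have h4 : ∑' i, m i * cutNumer cs w (a i) ≤ ∑' i, m i * (σ * farPairC w (a i)) :=
    Summable.tsum_le_tsum (fun i => mul_le_mul_of_nonneg_left (hK (a i) (hstrip i)) (hm i)) hsumN hsumS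
  have h5 : ∑' i, m i * (σ * farPairC w (a i)) = σ * ∑' i, m i * farPairC w (a i) := by
    rw [← tsum_mul_left]
    exact tsum_congr fun i => by ring
  unfold Lcert
  rw [hE]
  linarith [h2, h3, h4, h5]

/-! ## §4 The explicit real-part two-point certificate and its conjectural kernel law -/

/-- the REAL-PART TWO-POINT family: direction `e = −1` at the foot `p0 = xv + i·Im w` (= `linePt v w`) with weight `y0` and at the box top `p1 = xv + i·h`
with weight `1 − y0`. -/
def realTwoPoint (xv h y0 : ℝ) (w : ℂ) : Fin 2 → Cut :=
  ![⟨⟨xv, w.im⟩, -1, y0⟩, ⟨⟨xv, h⟩, -1, 1 - y0⟩]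

/-- CONE datum: `|Re w − xv|·(R − |Re w − xv|) < (Im w)²`, i.e. `c(u) > 0` on the whole maximal strip. -/
def ConeChild (xv R : ℝ) (w : ℂ) : Prop := |w.re - xv| * (R - |w.re - xv|) < w.im ^ 2

/-- the ratio `N(z)/c(z)` of a cut family at a point `z` (read at the two TOP CORNERS `xv ± R/2 + i·R/2`). -/
def cornerRatio (cs : κ → Cut) (w z : ℂ) : ℝ := cutNumer cs w z / farPairC w z

/-- `σ*`: the larger of the two top-corner ratios. -/
def cornerSigma (xv R : ℝ) (cs : κ → Cut) (w : ℂ) : ℝ :=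
  max (cornerRatio cs w ⟨xv + R / 2, R / 2⟩) (cornerRatio cs w ⟨xv - R / 2, R / 2⟩)

/-- CORNER DOMINANCE — a CONJECTURE, typed with its tested scope as hypotheses (floating point only: 0 failures in ≈ 22 000 cases, frames `6 ≤ R/s ≤ 150`,
`3h < R`, boxes `h = R/3 … R/6.5`, drops `< s/4`, all weights `y0 ∈ [0,1]`; FALSE for lids thinner than `R/2`, hence posed on the maximal strip): for a cone
datum and a shallow nested child the real-part two-point family is dominated ON THE BOUNDARY with `σ = σ*`.  (With `LemmaHSig`: on the whole strip.) -/
def CornerDominanceSig : Prop :=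
  ∀ (xv R s h y0 : ℝ) (v w : ℂ),
    0 < s → 6 * s ≤ R → 3 * h < R → v.re = xv → 0 < v.im → v.im ≤ h →
    0 < w.im → w.im < v.im → v.im - s / 4 < w.im → (w.re - xv) ^ 2 + w.im ^ 2 ≤ v.im ^ 2 →
    ConeChild xv R w → 0 ≤ y0 → y0 ≤ 1 →
    KernelDomBdry xv R (realTwoPoint xv h y0 w) w (cornerSigma xv R (realTwoPoint xv h y0 w) w)

/-! ## §5 The near-axis rule R1 (one imaginary read at the box top) -/

/-- the closed-form FOOT RATIO of rule R1 at `δ = 0`: `ρ(y, h, R) = (h/y)·((R/2)² + y²)/((R/2)² + h²)` — the value of `c₁(a)/c(a)` (`c₁(u) = −Im K_u(p1)`,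
`p1 = xv + i·h`, `w = xv + i·y`) at a REAL far point `a = xv ± R/2`, where `K_a(z) = 2/(z − a)`. -/
def rhoClosed (y h R : ℝ) : ℝ := (h / y) * ((R / 2) ^ 2 + y ^ 2) / ((R / 2) ^ 2 + h ^ 2)

/-- `ρ > 1` as soon as `h·y < (R/2)²` — always in the sink's frames (`R/2 > h > y > 0`): the box top sees MORE imaginary far field than the child. -/
theorem one_lt_rhoClosed {y h R : ℝ} (hy : 0 < y) (hyh : y < h) (hR : h * y < (R / 2) ^ 2) : 1 < rhoClosed y h R := by
  unfold rhoClosed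
  have h0 : 0 < h := hy.trans hyh
  have hden : 0 < (R / 2) ^ 2 + h ^ 2 := by positivity
  rw [lt_div_iff₀ hden, one_mul, div_mul_eq_mul_div, lt_div_iff₀ hy]
  nlinarith [mul_pos h0 hy, sub_pos.mpr hyh]

/-- R1 BOOKKEEPING (the one-cut instance of the assembly, written out over abstract sequences): a far family with masses `m i ≥ 0`, termwise domination
`ρ·c ≤ c₁`, the imaginary identity (E) `Q = Σ' m·c` at the child and the top's imaginary read `Σ' m·c₁ ≤ L` force `ρ·Q ≤ L`.  With `ρ > 1` and the cap
`L ≤ 1/(2s)`, every child with `Q > 1/(2s)` is excluded. -/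
theorem r1_bound {ι : Type} (m c c1 : ι → ℝ) (ρ Q L : ℝ)
    (hm : ∀ i, 0 ≤ m i) (hdom : ∀ i, ρ * c i ≤ c1 i)
    (hc : Summable fun i => m i * c i) (hc1 : Summable fun i => m i * c1 i)
    (hE : Q = ∑' i, m i * c i) (htop : ∑' i, m i * c1 i ≤ L) : ρ * Q ≤ L := by
  have h1 : ∑' i, ρ * (m i * c i) ≤ ∑' i, m i * c1 i :=
    Summable.tsum_le_tsum (fun i => by nlinarith [hm i, hdom i, mul_le_mul_of_nonneg_left (hdom i) (hm i)]) (hc.mul_left ρ) hc1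
  rw [hE, ← tsum_mul_left]
  exact h1.trans htop

/-! ## §6 The reduction target: certificates exist -/

/-- THE TEMPLATE'S CLAIM for exponent `lam` (OPEN; numerically `lam = √5/2` with margin on frames `26·s ≤ R`, where the three-cut family
`{Re@p0, Re@p1, Im@p1}` already suffices — memo §3(c‴)): for every frame / state / shallow nested child in the sink's scope and every multiplicity
`mult ≥ 1` of the tracked state there is an admissible finite cut family on the two axis points `{xv + i·Im w, xv + i·h}` and a multiplier `σ` with kernel
domination on the maximal strip and the datum alternative — the level computed at the read value `G = −mult·farPairK v w` (`= lineRem f j v R w` at a child,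
Q-m), the modulus bounded being the one-copy far field `‖farPairK v w‖ = ‖farFieldAt f j v w‖`.  The model binders (`drop < s/4`, nested step) are what the
tree's binders of `RhW08.FLink.FarFieldModulusLawBoxPl` give via `quarter_high_of_charged` and the nested-step lemma of the seam files. -/
def CertificatesExistSig (lam : ℝ) : Prop :=
  ∀ (xv R s h : ℝ) (v w : ℂ) (mult : ℕ),
    0 < s → 2 * s ≤ h → 3 * h < R → v.re = xv → 0 < v.im → v.im ≤ h →
    0 < w.im → w.im < v.im → v.im - s / 4 < w.im → (w.re - xv) ^ 2 + w.im ^ 2 ≤ v.im ^ 2 → 1 ≤ mult →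
    ∃ (n : ℕ) (cs : Fin n → Cut) (σ : ℝ), CutsAdmissible xv cs ∧ (∀ k, (cs k).p = ⟨xv, w.im⟩ ∨ (cs k).p = ⟨xv, h⟩) ∧
      KernelDom xv R cs w σ ∧
      DatumAlt lam s ‖farPairK v w‖ cs (-((mult : ℂ) * farPairK v w)) σ

end RhW08.SinkTemplate

end
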